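import Mathlib
import Literature.AlgebraicGeometry.Resolution.LogRegularAtlasGluing
import Literature.AlgebraicGeometry.Resolution.BoundarySpread
import Literature.AlgebraicGeometry.Resolution.KummerChartFromSections
import Summits.ResolutionOfSingularities.ResolutionOfSingularities.Theorems.PAlterationPicoverLocalModelLocalChartsDispatch
import Summits.ResolutionOfSingularities.ResolutionOfSingularities.Theorems.PAlterationPicoverLocalModelLocalChartsPointData

/-!
# Crux `PicoverLocalModel` (stmt-ResolutionOfSingularities-0557), line `SketchIdeator3`
# (giraud-cossart-normal-form) — endgame, local charts: the chart at a point over a Kummer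
# centre

Helper of the stub `stub_localCharts`: assembly of the local log-regular chart of the
normalised cover `(normalization Y, ν ≫ q)` at a point `y` whose image `w ∈ W` is a Kummer
centre of the Giraud normal form (`a = g^p + v ∏ x_j^{A_j}`, `v` a unit, `p ∤ A_{j₀}`), for a
finite surjective `q : Y → W` whose sections over affine opens of `W` are generated by a
`p`-th root of `π^* a` (the pulled-back `p`-cyclic cover): spread the data to an affine
`U ∋ w` (`exists_affineOpen_spread`), twist (`x_{j₀} ↦ v^{c₀} x_{j₀}`), take
`V = (ν ≫ q)⁻¹ U` and the Kummer chart `Φ : kummerCone p j₀ c → Γ(Y^ν, V)`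
(`exists_kummerChart`), and verify Kato's condition at every prime and the prescribed stalk
monoids at every point of `V` by `localChart_pointwise_kummer`.
-/

noncomputable section

-- single-problem summit: the doubled namespace component `ResolutionOfSingularities` is the tree layout
set_option linter.dupNamespace false

open CategoryTheory CategoryTheory.Limits AlgebraicGeometry TopologicalSpace Polynomial IsLocalRing
open Literature.AlgebraicGeometry.Resolution

namespace Summit.ResolutionOfSingularities.ResolutionOfSingularities.Theorems.PicoverLocalModel.LocalCharts

/-- The localization instance at a point, for an ideal equal to its prime. [folklore] -/
theorem isLocalization_atPrime_of_eq {A O : Type*} [CommRing A] [CommRing O] [Algebra A O]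
    (𝔮 𝔮' : Ideal A) [𝔮.IsPrime] [𝔮'.IsPrime] (h : 𝔮' = 𝔮) [IsLocalization.AtPrime O 𝔮] :
    IsLocalization.AtPrime O 𝔮' := by
  have hS : 𝔮'.primeCompl = 𝔮.primeCompl := Submonoid.ext fun z => by
    change z ∉ 𝔮' ↔ z ∉ 𝔮; rw [h]
  change IsLocalization 𝔮'.primeCompl O
  rw [hS]; infer_instance

/-- A nontrivial algebra over a field of characteristic `p` has characteristic `p`.
[folklore] -/
theorem charP_of_algebra_field {k A : Type*} [Field k] [CommRing A] [Nontrivial A] [Algebra k A]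
    (p : ℕ) [CharP k p] : CharP A p :=
  charP_of_injective_algebraMap (algebraMap k A).injective p

/-- **The local chart at a point over a Kummer centre.** See the module docstring.
[cite: Kato1994, Def. (2.1) and Thm. 11.6] -/
theorem localChart_kummerCentre : ∀ (p : ℕ) [Fact p.Prime] (k : Type) [Field k] [CharP k p] (W : Scheme.{0}) (f : W ⟶ Spec (.of k)) [LocallyOfFiniteType f] [IsIntegral W], Scheme.IsRegular W → ∀ (R : Type) [CommRing R] (π : W ⟶ Spec (.of R)) (a : R) (E : List W.IdealSheafData), HasSNC E → InGiraudNormalForm p W π a E → ∀ (Y : Scheme.{0}) [IsIntegral Y] (q : Y ⟶ W) [IsFinite q] [Surjective q], (∀ U : W.affineOpens, ∃ tY : Γ(Y, q ⁻¹ᵁ (U : W.Opens)), tY ^ p = q.app U (π.appLE ⊤ U le_top ((Scheme.ΓSpecIso (.of R)).inv a)) ∧ ∀ b : Γ(Y, q ⁻¹ᵁ (U : W.Opens)), ∃ P : Γ(W, U)[X], b = P.eval₂ (q.app U).hom tY) → ∀ (y : ↥(normalization Y)) (w : W) (hw : (normalizationι Y ≫ q).base y = w) {r : ℕ} (D : Fin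 r → {D : W.IdealSheafData // D ∈ E ∧ w ∈ D.support}) (x : Fin r → W.presheaf.stalk w), Function.Bijective D → (∀ j, stalkIdeal (D j).1 w = Ideal.span {x j}) → ∀ (g₀ : W.presheaf.stalk w) (Aexp : Fin r → ℕ) (v₀ : (W.presheaf.stalk w)ˣ) (j₀ : Fin r), ¬ p ∣ Aexp j₀ → (W.presheaf.germ ⊤ w trivial) (π.appTop ((Scheme.ΓSpecIso (.of R)).inv a)) = g₀ ^ p + (v₀ : W.presheaf.stalk w) * ∏ j, x j ^ Aexp j → Nonempty (LocalLogRegularChart (normalization Y) (fun y => divisorialMonoid (((E.map fun D => stalkIdeal D ((normalizationι Y ≫ q).base y))).prod.map ((normalizationι Y ≫ q).stalkMap y).hom)) y) := by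
  intro p _ k _ _ W f _ _ hreg R _ π a E hE hG Y _ q _ _ hsec y w hw r D x hDbij hDgen g₀ Aexp v₀ j₀ hj₀ ha₀
  classical
  have hp : p.Prime := Fact.out
  haveI : IsLocallyNoetherian W := LocallyOfFiniteType.isLocallyNoetherian f
  set gq := normalizationι Y ≫ q with hgq
  -- the centre
  haveI hregw : IsRegularLocalRing (W.presheaf.stalk w) := hreg w
  haveI := isDomain_of_isRegularLocalRing (W.presheaf.stalk w)
  obtain ⟨hxm, hli⟩ := hli_of_hasSNC hE w D hDbij.1 x hDgen
  have hxprime : ∀ j, (Ideal.span {x j}).IsPrime := RegularParameters.isPrime_span_singleton hxm hli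
  have hx0 : ∀ j, x j ≠ 0 := fun j h0 => RegularParameters.notMem_sq hli j (h0 ▸ Ideal.zero_mem _)
  -- spread to an affine open `U ∋ w`
  obtain ⟨U, hwU, xs, fs, us, hxs, hfs, hus, husu, hB1, hB2, hprime⟩ :=
    exists_affineOpen_spread E w D (fun D' hD' hsupp => hDbij.2 ⟨D', hD', hsupp⟩ |>.imp fun j hj =>
      congrArg Subtype.val hj) x hDgen hxprime ![g₀] ![(v₀ : W.presheaf.stalk w)]
      (fun k => by fin_cases k; exact Units.isUnit v₀)
  set gs := fs 0 with hgs
  set vs := us 0 with hvs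
  have hvsu : IsUnit vs := husu 0
  set aU : Γ(W, (U : W.Opens)) := π.appLE ⊤ U le_top ((Scheme.ΓSpecIso (.of R)).inv a) with haU
  have hgerm_aU : W.presheaf.germ (U : W.Opens) w hwU aU =
      W.presheaf.germ ⊤ w trivial (π.appTop ((Scheme.ΓSpecIso (.of R)).inv a)) := by
    rw [haU, Scheme.Hom.appLE, CommRingCat.comp_apply]
    exact TopCat.Presheaf.germ_res_apply W.presheaf (homOfLE le_top) w hwU _
  -- the identity in `A = Γ(W, U)`
  have hA : aU = gs ^ p + vs * ∏ j, xs j ^ Aexp j := by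
    apply germ_injective_of_isIntegral (X := W) w hwU
    rw [hgerm_aU, ha₀, map_add, map_pow, map_mul, map_prod]
    simp only [map_pow, hxs, hgs, hvs, hfs, hus]
    rfl
  -- the Kummer twist
  obtain ⟨c₀, hc₀⟩ := exists_mul_mod_eq_one (p := p) hj₀
  set m₀ : ℕ := c₀ * Aexp j₀ / p with hm₀def
  have hm₀ : c₀ * Aexp j₀ = p * m₀ + 1 := by
    have := Nat.div_add_mod (c₀ * Aexp j₀) p
    rw [hc₀] at this; rw [hm₀def]; exact this.symm
  let xs' : Fin r → Γ(W, (U : W.Opens)) := fun j => if j = j₀ then vs ^ c₀ * xs j else xs j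
  let u₁ : Γ(W, (U : W.Opens)) := ↑(hvsu.unit⁻¹) ^ m₀
  have hu₁ : IsUnit u₁ := (Units.isUnit _).pow _
  have hA' : aU - gs ^ p = u₁ ^ p * ∏ j, xs' j ^ Aexp j := by
    have h1 : ∏ j, xs' j ^ Aexp j = vs ^ (c₀ * Aexp j₀) * ∏ j, xs j ^ Aexp j := by
      have : ∀ j, xs' j ^ Aexp j = (if j = j₀ then vs ^ c₀ else 1) ^ Aexp j * xs j ^ Aexp j := by
        intro j; simp only [xs']; split_ifs <;> ring
      rw [Finset.prod_congr rfl fun j _ => this j, Finset.prod_mul_distrib]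
      congr 1
      rw [Finset.prod_eq_single j₀ (fun j _ hj => by simp [hj]) (by simp)]
      simp [pow_mul]
    rw [h1, hm₀, hA]
    have hvinv : (↑(hvsu.unit⁻¹) : Γ(W, (U : W.Opens))) * vs = 1 := hvsu.val_inv_mul
    calc gs ^ p + vs * ∏ j, xs j ^ Aexp j - gs ^ p = vs * ∏ j, xs j ^ Aexp j := by ring
      _ = vs * ((↑(hvsu.unit⁻¹) : Γ(W, (U : W.Opens))) * vs) ^ (p * m₀) * ∏ j, xs j ^ Aexp j := by
          rw [hvinv, one_pow, mul_one]
      _ = u₁ ^ p * (vs ^ (p * m₀ + 1) * ∏ j, xs j ^ Aexp j) := by simp only [u₁]; ring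
  have hB1' : ∀ j, (D j).1.ideal U = Ideal.span {xs' j} := by
    intro j
    rw [hB1 j]
    simp only [xs']
    split_ifs
    · exact (Ideal.span_singleton_mul_left_unit (hvsu.pow c₀) (xs j)).symm
    · rfl
  have hprime' : ∀ j, (Ideal.span {xs' j}).IsPrime := fun j => by rw [← hB1' j, hB1 j]; exact hprime j
  have hxs0 : ∀ j, xs' j ≠ 0 := by
    intro j h0
    have : xs j = 0 := by
      simp only [xs'] at h0
      split_ifs at h0 with hj
      · exact ((hvsu.pow c₀).mul_right_eq_zero).mp h0
      · exact h0
    apply hx0 j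
    rw [← hxs j, this, map_zero]
  -- sections of the normalised cover over `U`
  obtain ⟨tY, htYp, hgen⟩ := hsec U
  have hyV : y ∈ gq ⁻¹ᵁ (U : W.Opens) := by
    change gq.base y ∈ (U : W.Opens); rw [hgq, hw]; exact hwU
  obtain ⟨hVaff, hic, hint, hinj, t, ht, hbir⟩ :=
    sections_normalization_of_generated q U hp.ne_zero aU tY htYp hgen ⟨⟨y, hyV⟩⟩
  haveI : Nonempty (gq ⁻¹ᵁ (U : W.Opens)) := ⟨⟨y, hyV⟩⟩
  haveI : Nonempty (U : W.Opens) := ⟨⟨w, hwU⟩⟩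
  letI algAB : Algebra Γ(W, (U : W.Opens)) Γ(normalization Y, gq ⁻¹ᵁ (U : W.Opens)) :=
    (gq.app U).hom.toAlgebra
  have halg : ∀ s, algebraMap Γ(W, (U : W.Opens)) Γ(normalization Y, gq ⁻¹ᵁ (U : W.Opens)) s =
      gq.app U s := fun s => rfl
  haveI : Algebra.IsIntegral Γ(W, (U : W.Opens)) Γ(normalization Y, gq ⁻¹ᵁ (U : W.Opens)) :=
    ⟨fun z => hint z⟩
  haveI : IsIntegrallyClosed Γ(normalization Y, gq ⁻¹ᵁ (U : W.Opens)) := hic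
  have hinj' : Function.Injective (algebraMap Γ(W, (U : W.Opens)) Γ(normalization Y, gq ⁻¹ᵁ (U : W.Opens))) :=
    hinj
  haveI : CharP Γ(W, (U : W.Opens)) p :=
    charP_of_injective_ringHom ((Scheme.ΓSpecIso (.of k)).inv ≫ f.appLE ⊤ U le_top).hom.injective p
  haveI : CharP Γ(normalization Y, gq ⁻¹ᵁ (U : W.Opens)) p := charP_of_injective_ringHom hinj' p
  have ht' : t ^ p = algebraMap _ _ aU := ht
  have hbir' : ∀ z : Γ(normalization Y, gq ⁻¹ᵁ (U : W.Opens)), ∃ d : Γ(W, (U : W.Opens)), d ≠ 0 ∧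
      ∃ P : Γ(W, (U : W.Opens))[X], algebraMap _ _ d * z = aeval t P := by
    intro z; obtain ⟨d, hd, P, hP⟩ := hbir z; refine ⟨d, hd, P, ?_⟩; rw [aeval_def]; exact hP
  -- the Kummer chart
  obtain ⟨Φ, hΦ⟩ := exists_kummerChart p hinj' xs' hxs0 Aexp j₀ c₀ hc₀ aU gs u₁ hu₁ hA' t ht'
  -- data along `E`
  have hDE : ∀ j, (D j).1 ∈ E := fun j => (D j).2.1
  have hDinj : Function.Injective (fun j => (D j).1) := fun i j h => hDbij.1 (Subtype.ext h)
  -- the centre as a localization of `A`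
  letI := W.presheaf.algebra_section_stalk (⟨w, hwU⟩ : (U : W.Opens))
  haveI := U.2.isLocalization_stalk ⟨w, hwU⟩
  have hmem𝔮 : ∀ (w' : W) (hw' : w' ∈ (U : W.Opens)) (s : Γ(W, (U : W.Opens))),
      s ∈ (U.2.primeIdealOf ⟨w', hw'⟩).asIdeal ↔ ¬ IsUnit (W.presheaf.germ (U : W.Opens) w' hw' s) := by
    intro w' hw' s
    letI := W.presheaf.algebra_section_stalk (⟨w', hw'⟩ : (U : W.Opens))
    haveI := U.2.isLocalization_stalk ⟨w', hw'⟩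
    rw [← IsLocalization.AtPrime.to_map_mem_maximal_iff (W.presheaf.stalk w') (U.2.primeIdealOf ⟨w', hw'⟩).asIdeal s,
      IsLocalRing.mem_maximalIdeal, mem_nonunits_iff]
    rfl
  obtain ⟨hxm', hli₀⟩ := hli_of_hasSNC hE w D hDbij.1 (fun j => W.presheaf.germ (U : W.Opens) w hwU (xs' j))
    fun j => stalkIdeal_eq_span_germ_of_spread (D := fun j => (D j).1) hB1' hwU j
  have hx₀ : ∀ j, xs' j ∈ (U.2.primeIdealOf ⟨w, hwU⟩).asIdeal := fun j =>
    (hmem𝔮 w hwU _).mpr fun hu => (IsLocalRing.mem_maximalIdeal _).mp (hxm' j) hu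
  -- Kato's condition and the stalk monoid at every point of `V`, via the local model
  have perPoint : ∀ (y' : ↥(normalization Y)) (hy' : y' ∈ gq ⁻¹ᵁ (U : W.Opens)) (N : Type) [CommRing N]
      [Algebra Γ(normalization Y, gq ⁻¹ᵁ (U : W.Opens)) N]
      [IsLocalization.AtPrime N (hVaff.primeIdealOf ⟨y', hy'⟩).asIdeal],
      LogChart.IsLogRegularLocal (kummerCone p j₀ (fun j => c₀ * Aexp j % p))
        ((algebraMap Γ(normalization Y, gq ⁻¹ᵁ (U : W.Opens)) N).toMonoidHom.comp Φ) ∧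
      ∀ σN : W.presheaf.stalk (gq.base y') →+* N,
        σN.comp (W.presheaf.germ (U : W.Opens) (gq.base y') hy').hom =
          (algebraMap Γ(normalization Y, gq ⁻¹ᵁ (U : W.Opens)) N).comp (algebraMap Γ(W, (U : W.Opens)) _) →
        divisorialMonoid (Ideal.span {σN (W.presheaf.germ (U : W.Opens) (gq.base y') hy' (∏ j, xs' j))}) =
          IsUnit.submonoid N ⊔ MonoidHom.mrange ((algebraMap Γ(normalization Y, gq ⁻¹ᵁ (U : W.Opens)) N).toMonoidHom.comp Φ) := by
    intro y' hy' N _ _ _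
    have hw'U : gq.base y' ∈ (U : W.Opens) := hy'
    letI := W.presheaf.algebra_section_stalk (⟨gq.base y', hw'U⟩ : (U : W.Opens))
    haveI := U.2.isLocalization_stalk ⟨gq.base y', hw'U⟩
    haveI : IsRegularLocalRing (W.presheaf.stalk (gq.base y')) := hreg _
    have hcomap : ((hVaff.primeIdealOf ⟨y', hy'⟩).asIdeal).comap
        (algebraMap Γ(W, (U : W.Opens)) Γ(normalization Y, gq ⁻¹ᵁ (U : W.Opens))) =
        (U.2.primeIdealOf ⟨gq.base y', hw'U⟩).asIdeal := by
      ext s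
      rw [Ideal.mem_comap, halg, ← Scheme.Hom.appLE_eq_app]
      exact mem_primeIdealOf_iff_of_stalkMap gq U.2 hVaff le_rfl y' hy' s
    haveI : IsLocalization.AtPrime (W.presheaf.stalk (gq.base y'))
        (((hVaff.primeIdealOf ⟨y', hy'⟩).asIdeal).comap
          (algebraMap Γ(W, (U : W.Opens)) Γ(normalization Y, gq ⁻¹ᵁ (U : W.Opens)))) :=
      isLocalization_atPrime_of_eq _ _ hcomap
    have hmem' : ∀ s : Γ(W, (U : W.Opens)), s ∈ ((hVaff.primeIdealOf ⟨y', hy'⟩).asIdeal).comap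
        (algebraMap Γ(W, (U : W.Opens)) Γ(normalization Y, gq ⁻¹ᵁ (U : W.Opens))) ↔
        ¬ IsUnit (W.presheaf.germ (U : W.Opens) (gq.base y') hw'U s) := fun s => by
      rw [hcomap]; exact hmem𝔮 _ hw'U s
    have key := localChart_pointwise_kummer (O₀ := W.presheaf.stalk w) (O := W.presheaf.stalk (gq.base y'))
      (N := N) p xs' Aexp j₀ c₀ hc₀ aU gs u₁ hu₁ hA' hprime' hinj' t ht' hbir' Φ hΦ
      (U.2.primeIdealOf ⟨w, hwU⟩).asIdeal hx₀ hli₀ (hVaff.primeIdealOf ⟨y', hy'⟩).asIdeal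
      (fun s σ hσ hmem => (hli_of_spread (D := fun j => (D j).1) hDE hDinj hB1' hw'U hE σ hσ
        fun i => (hmem' (xs' (σ i))).mp (hmem i)).2)
      (fun s σ hσ hJ => pointData_giraudNormalFormAt hDE hDinj hB1' hB2 hw'U π a hG σ hσ
        fun j => (hmem' (xs' j)).symm.trans (hJ j))
    exact ⟨key.1, fun σN hσN => key.2 σN hσN⟩
  -- the chart record
  refine ⟨⟨⟨gq ⁻¹ᵁ (U : W.Opens), hVaff⟩, hyV, r, kummerCone p j₀ (fun j => c₀ * Aexp j % p), Φ,
    kummerCone_fg hp.pos j₀ _, kummerCone_saturated p j₀ _, span_kummerCone_eq_top p j₀ _,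
    fun 𝔓 _ => ?_, fun y' hy' => ?_⟩⟩
  · -- Kato's condition at `𝔓`
    obtain ⟨⟨y', hy'⟩, hy'𝔓⟩ := exists_point_of_prime hVaff 𝔓
    have h𝔓 : (hVaff.primeIdealOf ⟨y', hy'⟩).asIdeal = 𝔓 := by rw [hy'𝔓]
    haveI : IsLocalization.AtPrime (Localization.AtPrime 𝔓) (hVaff.primeIdealOf ⟨y', hy'⟩).asIdeal :=
      isLocalization_atPrime_of_eq _ _ h𝔓
    rw [LogChart.isLogRegularAt_iff_isLogRegularLocal]
    exact (perPoint y' hy' (Localization.AtPrime 𝔓)).1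
  · -- the stalk monoid at `y'`
    letI := (normalization Y).presheaf.algebra_section_stalk (⟨y', hy'⟩ : gq ⁻¹ᵁ (U : W.Opens))
    haveI := hVaff.isLocalization_stalk ⟨y', hy'⟩
    have hσN : (gq.stalkMap y').hom.comp (W.presheaf.germ (U : W.Opens) (gq.base y') hy').hom =
        (algebraMap Γ(normalization Y, gq ⁻¹ᵁ (U : W.Opens)) ((normalization Y).presheaf.stalk y')).comp
          (algebraMap Γ(W, (U : W.Opens)) _) := by
      have := Scheme.Hom.germ_stalkMap gq (U : W.Opens) y' hy'
      rw [← CommRingCat.hom_comp, this, CommRingCat.hom_comp]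
      rfl
    have key := (perPoint y' hy' ((normalization Y).presheaf.stalk y')).2 (gq.stalkMap y').hom hσN
    change chartStalkMonoid _ Φ y' hy' =
      divisorialMonoid (((E.map fun D => stalkIdeal D (gq.base y')).prod).map (gq.stalkMap y').hom)
    rw [pointData_divisorialMonoid (D := fun j => (D j).1) hDE hB1' hB2 hy' (gq.stalkMap y').hom, key,
      chartStalkMonoid, MonoidHom.map_mrange]
    rfl

end Summit.ResolutionOfSingularities.ResolutionOfSingularities.Theorems.PicoverLocalModel.LocalCharts

end
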